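import Summits.QuantumFields.YangMills.Theorems.LocalInsertionInsertionStepOfConcentration
import Summits.QuantumFields.YangMills.Theorems.LocalInsertionWindowTailOfConcentrationBoxFit
import HarnessLib

/-!
# Line «local_insertion» on crux `HistoryTailL` (stmt-QuantumFields-19936) — THE INSERTION STEP AT EVERY HEIGHT WHOSE K1 BOX FITS
# (by-name layer over ✓`WindowTailOfConcentrationBoxFit.windowTail_step_of_boxFit`; all heights `1 ≤ j ≤ K` except the top corner of tiny tori)

Cell `ym3-torus` (YM ladder rung R3 = continuum SU(2) Yang–Mills on the three-torus — a RUNG, NOT the Clay problem: not d = 4, not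
infinite volume, not a mass gap), width seat `ym-ust-19936-w3` gen 11, `--supports stmt-QuantumFields-19936 --as helper`.  THEOREMS ONLY,
definition-free; by-name layer in the route cone (imports file C).  HONEST FRAMING: CONDITIONAL steps — `hK1` (text of `MesoscopicConcentrationL`,
stmt-23532), the window-Lipschitz family at ALL heights (the item `BlockLipschitzL` 23533 only speaks for `j + 2 ≤ K`; at the top heights the
row is a plain hypothesis text here) and the median family at scale `g` are NOT in the tree.  Nothing of `LocalInsertionL` (23607), 23608,
the stubs of `Cruxes/HistoryTailL/Lines/local_insertion.lean`, the crux `HistoryTailL` or any summit statement is proved.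

* ★★`insertion_step_of_boxFit`: one instance, any `j ≤ K` under `2·17L^j ≤ 2L^{F.m+K}` and `17L^j ≤ β_K`: `hK1 ∧ hK2 ∧ hMed ⇒` the LocalInsertionL
  integrand bound `(t₀+1)e^{ε(t₀+1)} + 2Cc·e^{ε+(ε+1)²/(4c)}`, every `ε ≥ 0`.
* ★★`insertionFits_of_concentration_median` (BY NAME for K1): `MesoscopicConcentrationL` ∧ ⟨window-Lipschitz family, all heights⟩ ∧ ⟨median family at
  scale g, all heights, `m` chosen after `(b₀,p₀)`⟩ ⇒ the integrand bound at EVERY height with `3 ≤ F.m + K − j` (γ ≤ 1/17), every `ε ≥ 0` —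
  i.e. item 23607's full height range on every unit torus with `F.m ≥ 3`; on the tiny tori `F.m ∈ {1,2}` the top `3 − F.m` heights stay outside
  K1's text (the «local» box would be the whole torus).
[cite: Balaban1985UV3, (3) p.256, (7) p.257 and (71) p.273]
-/

set_option autoImplicit false

noncomputable section

open scoped BigOperators
open MeasureTheory Set
open Literature.MathematicalPhysics.QuantumFieldTheory.Balaban1983to89
open Literature.MathematicalPhysics.QuantumFieldTheory.Balaban1983to89.T3ContinuumYM3Torus
open Literature.MathematicalPhysics.QuantumFieldTheory.Balaban1983to89.T3UnitScaleTilt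
open Literature.MathematicalPhysics.QuantumFieldTheory.Balaban1983to89.T3UnitLawDensityEML
open Summit.QuantumFields.YangMills.Theorems.LocalInsertion.MomentOfWindowTail (insertionIntegral_le_of_gaussTail measurableSet_window)
open Summit.QuantumFields.YangMills.Theorems.LocalInsertion.WindowTailOfConcentrationBoxFit
  (windowTail_step_of_boxFit boxFit_of_depth boxBeta_of_coupling)
open Summit.QuantumFields.YangMills.Theorems.LocalInsertion.InsertionStepOfConcentration (insertionBound_nonneg)

namespace Summit.QuantumFields.YangMills.Theorems.LocalInsertion.InsertionStepOfConcentrationBoxFit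

/-- **THE INSERTION STEP UNDER THE BOX-FIT CONDITIONS** (one instance, any height `j ≤ K`): `hK1 ∧ hK2 ∧ hMed` and the two fit conditions
bound the LocalInsertionL integrand for EVERY `ε ≥ 0` and every profile, with the constants of ✓`InsertionStepOfConcentration.insertion_step`.
[cite: Balaban1985UV3, (7) p.257 and (71) p.273] -/
theorem insertion_step_of_boxFit (F : T3Family) {γ b₀ p₀ ε : ℝ} (hγ : 0 < γ) (hε : 0 ≤ ε)
    {K j : ℕ} (hjK : j ≤ K) (h2n : 2 * (17 * F.L ^ j) ≤ (F.P K).sitesPerDir 0) (hnβ : ((17 * F.L ^ j : ℕ) : ℝ) ≤ (F.scheme ℰp γ).β K)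
    (a : Plaq (F.P K) j) {Cc cc CL m : ℝ} (hCc : 0 ≤ Cc) (hcc : 0 < cc) (hCL : 0 ≤ CL) (hm : 0 ≤ m)
    (hK1 : ∀ (n : ℕ), 1 ≤ n → (n : ℝ) ≤ (F.scheme ℰp γ).β K → 2 * n ≤ (F.P K).sitesPerDir 0 →
      ∀ (x₀ : Site (F.P K) 0) (f : GaugeField (F.P K) 0 (Matrix.specialUnitaryGroup (Fin 2) ℂ) → ℝ) (Λ : ℝ), 0 < Λ → Measurable f → GaugeField.GaugeInvariant f →
      (∀ U U' : GaugeField (F.P K) 0 (Matrix.specialUnitaryGroup (Fin 2) ℂ), (∀ b : PBond (F.P K) 0, (∀ k, (b.src k - x₀ k).val < n) → (∀ k, (b.tgt k - x₀ k).val < n) → U b = U' b) →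
        f U = f U') →
      (∀ U U' : GaugeField (F.P K) 0 (Matrix.specialUnitaryGroup (Fin 2) ℂ), |f U - f U'| ≤ Λ * Real.sqrt (∑ b : PBond (F.P K) 0, GaugeGroup.dist1 (U b * (U' b)⁻¹) ^ 2)) →
      ∀ r : ℝ, 0 ≤ r → (gibbsK F ℰp γ K).real {U | r ≤ f U - ∫ V, f V ∂(gibbsK F ℰp γ K)} ≤
        Cc * Real.exp (-(cc * (F.scheme ℰp γ).β K * r ^ 2 / ((n : ℝ) ^ 2 * Λ ^ 2))))
    (hK2 : ∀ U U' : GaugeField (F.P K) 0 (Matrix.specialUnitaryGroup (Fin 2) ℂ), (∀ (i : ℕ) (q : Plaq (F.P K) i), i < j → Site.tdist (fun k => ((((q.src k).val * F.L ^ i : ℕ)) : ZMod ((F.P K).sitesPerDir 0))) (fun k => ((((a.src k).val * F.L ^ j : ℕ)) : ZMod ((F.P K).sitesPerDir 0))) + 64 * F.L ^ i ≤ 64 * F.L ^ j → GaugeGroup.dist1 (GaugeField.plaqHol (Averaging.iter (fun i' => BlockAveraging.blockAvg (P := F.P K) (j := i') ℰp) i U) q) < θBal F.L γ b₀ p₀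 (K - i)) → (∀ (i : ℕ) (q : Plaq (F.P K) i), i < j → Site.tdist (fun k => ((((q.src k).val * F.L ^ i : ℕ)) : ZMod ((F.P K).sitesPerDir 0))) (fun k => ((((a.src k).val * F.L ^ j : ℕ)) : ZMod ((F.P K).sitesPerDir 0))) + 64 * F.L ^ i ≤ 64 * F.L ^ j → GaugeGroup.dist1 (GaugeField.plaqHol (Averaging.iter (fun i' => BlockAveraging.blockAvg (P := F.P K) (j := i') ℰp) i U') q) < θBal F.L γ b₀ p₀ (K - i)) →
      |GaugeGroup.dist1 (GaugeField.plaqHol (Averaging.iter (fun i' => BlockAveraging.blockAvg (P := F.P K) (j := i') ℰp) j U) a) - GaugeGroup.dist1 (GaugeField.plaqHol (Averaging.iter (fun i' => BlockAveraging.blockAvg (P := F.P K) (j := i') ℰp) j U') a)| ≤ CL / Real.sqrt ((F.L : ℝ) ^ j) * Real.sqrt (∑ b : PBond (F.P K) 0, if (∀ k, (b.src k - ((((a.src k).val * F.L ^ j : ℕ)) : ZMod ((F.P K).sitesPerDir 0)) + ((8 * F.L ^ j : ℕ) : ZMod ((F.P K).sitesPerDir 0))).val < 17 * F.L ^ j)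 ∧ (∀ k, (b.tgt k - ((((a.src k).val * F.L ^ j : ℕ)) : ZMod ((F.P K).sitesPerDir 0)) + ((8 * F.L ^ j : ℕ) : ZMod ((F.P K).sitesPerDir 0))).val < 17 * F.L ^ j) then GaugeGroup.dist1 (U b * (U' b)⁻¹) ^ 2 else 0))
    (hMed : 1 / 2 ≤ (gibbsK F ℰp γ K).real ({U : GaugeField (F.P K) 0 (Matrix.specialUnitaryGroup (Fin 2) ℂ) | (∀ (i : ℕ) (q : Plaq (F.P K) i), i < j → Site.tdist (fun k => ((((q.src k).val * F.L ^ i : ℕ)) : ZMod ((F.P K).sitesPerDir 0))) (fun k => ((((a.src k).val * F.L ^ j : ℕ)) : ZMod ((F.P K).sitesPerDir 0))) + 64 * F.L ^ i ≤ 64 * F.L ^ j → GaugeGroup.dist1 (GaugeField.plaqHol (Averaging.iter (fun i' => BlockAveraging.blockAvg (P := F.P K) (j := i') ℰp) i U) q) < θBal F.L γ b₀ p₀ (K - i))} ∩ {U | GaugeGroup.dist1 (GaugeField.plaqHol (Averaging.iter (fun i' => BlockAveraging.blockAvg (P := F.P K) (j := i') ℰp) j U) a) ≤ m * Real.sqrt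 (γ * ((F.L : ℝ)⁻¹) ^ (K - j))})) :
    ∫ U in {U : GaugeField (F.P K) 0 (Matrix.specialUnitaryGroup (Fin 2) ℂ) | (∀ (i : ℕ) (q : Plaq (F.P K) i), i < j → Site.tdist (fun k => ((((q.src k).val * F.L ^ i : ℕ)) : ZMod ((F.P K).sitesPerDir 0))) (fun k => ((((a.src k).val * F.L ^ j : ℕ)) : ZMod ((F.P K).sitesPerDir 0))) + 64 * F.L ^ i ≤ 64 * F.L ^ j → GaugeGroup.dist1 (GaugeField.plaqHol (Averaging.iter (fun i' => BlockAveraging.blockAvg (P := F.P K) (j := i') ℰp) i U) q) < θBal F.L γ b₀ p₀ (K - i))}, Real.exp (ε * min (GaugeGroup.dist1 (GaugeField.plaqHol (Averaging.iter (fun i' => BlockAveraging.blockAvg (P := F.P K) (j := i') ℰp) j U) a) / Real.sqrt (γ * ((F.L : ℝ)⁻¹) ^ (K - j))) (B10.pFun b₀ p₀ (Real.sqrt (γ * ((F.L : ℝ)⁻¹) ^ (K - j))))) ∂(gibbsK F ℰp γ K) ≤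
      (2 * (m + (CL + 1) * Real.sqrt (578 * Cc / cc)) + 1) * Real.exp (ε * (2 * (m + (CL + 1) * Real.sqrt (578 * Cc / cc)) + 1)) + 2 * Cc * Real.exp (ε + (ε + 1) ^ 2 / (4 * (cc / (1156 * (CL + 1) ^ 2)))) := by
  have ht₀ : 0 ≤ 2 * (m + (CL + 1) * Real.sqrt (578 * Cc / cc)) := by
    have : 0 ≤ (CL + 1) * Real.sqrt (578 * Cc / cc) := mul_nonneg (by linarith) (Real.sqrt_nonneg _)
    linarith
  have hc : 0 < cc / (1156 * (CL + 1) ^ 2) := by positivity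
  exact insertionIntegral_le_of_gaussTail F hγ hε hc hCc ht₀ b₀ p₀ a (measurableSet_window F γ b₀ p₀ K j a)
    (fun n hn => windowTail_step_of_boxFit F hγ hjK h2n hnβ a hCc hcc hCL hK1 hK2 hMed n hn)

/-- **EVERY HEIGHT WHOSE BOX FITS, BY NAME FOR K1.**  `PoincareLipschitz.MesoscopicConcentrationL` (stmt-23532), a window-Lipschitz family at ALL
heights `1 ≤ j ≤ K` (hypothesis text; the item 23533 covers `j + 2 ≤ K` only) and a median family at scale `g` at all heights (`m` after `(b₀,p₀)`)
give the LocalInsertionL integrand bound at every height with `3 ≤ F.m + K − j` (so ALL heights of 23607 on unit tori with `F.m ≥ 3`), for every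
`ε ≥ 0`, with `γ₁ ≤ 1/17`.  CONDITIONAL: none of the three hypotheses is in the tree. [cite: Balaban1985UV3, (7) p.257 and (71) p.273] -/
theorem insertionFits_of_concentration_median
    (hK1 : Summit.QuantumFields.YangMills.Theses.PoincareLipschitz.MesoscopicConcentrationL)
    (hK2 : ∀ (L : ℕ), ∃ CL : ℝ, 0 ≤ CL ∧ ∀ (b₀ p₀ : ℝ), 0 < b₀ → 2 < p₀ → ∃ γ₁ : ℝ, 0 < γ₁ ∧ γ₁ ≤ 1 ∧ ∀ (F : T3Family) (γ : ℝ), F.L = L → 0 < γ → γ ≤ γ₁ → ∀ (K j : ℕ), 1 ≤ j → j ≤ K → ∀ (a : Plaq (F.P K) j) (U U' : GaugeField (F.P K) 0 (Matrix.specialUnitaryGroup (Fin 2) ℂ)), (∀ (i : ℕ) (q : Plaq (F.P K) i), i < j → Site.tdist (fun k => ((((q.src k).val * F.L ^ i : ℕ)) : ZMod ((F.P K).sitesPerDir 0))) (fun k => ((((a.src k).val * F.L ^ j : ℕ)) : ZMod ((F.P K).sitesPerDir 0))) + 64 * F.L ^ i ≤ 64 * F.L ^ j → GaugeGroup.dist1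 (GaugeField.plaqHol (Averaging.iter (fun i' => BlockAveraging.blockAvg (P := F.P K) (j := i') ℰp) i U) q) < θBal F.L γ b₀ p₀ (K - i)) → (∀ (i : ℕ) (q : Plaq (F.P K) i), i < j → Site.tdist (fun k => ((((q.src k).val * F.L ^ i : ℕ)) : ZMod ((F.P K).sitesPerDir 0))) (fun k => ((((a.src k).val * F.L ^ j : ℕ)) : ZMod ((F.P K).sitesPerDir 0))) + 64 * F.L ^ i ≤ 64 * F.L ^ j → GaugeGroup.dist1 (GaugeField.plaqHol (Averaging.iter (fun i' => BlockAveraging.blockAvg (P := F.P K) (j := i') ℰp) i U') q) < θBal F.L γ b₀ p₀ (K - i)) →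
      |GaugeGroup.dist1 (GaugeField.plaqHol (Averaging.iter (fun i' => BlockAveraging.blockAvg (P := F.P K) (j := i') ℰp) j U) a) - GaugeGroup.dist1 (GaugeField.plaqHol (Averaging.iter (fun i' => BlockAveraging.blockAvg (P := F.P K) (j := i') ℰp) j U') a)| ≤ CL / Real.sqrt ((F.L : ℝ) ^ j) * Real.sqrt (∑ b : PBond (F.P K) 0, if (∀ k, (b.src k - ((((a.src k).val * F.L ^ j : ℕ)) : ZMod ((F.P K).sitesPerDir 0)) + ((8 * F.L ^ j : ℕ) : ZMod ((F.P K).sitesPerDir 0))).val < 17 * F.L ^ j) ∧ (∀ k, (b.tgt k - ((((a.src k).val * F.L ^ j : ℕ)) : ZMod ((F.P K).sitesPerDir 0)) + ((8 * F.L ^ j : ℕ) : ZMod ((F.P K).sitesPerDir 0))).val < 17 * F.L ^ j) then GaugeGroup.dist1 (U b * (U' b)⁻¹) ^ 2 else 0))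
    (hMed : ∀ (L : ℕ) (b₀ p₀ : ℝ), 0 < b₀ → 2 < p₀ → ∃ m : ℝ, 0 ≤ m ∧ ∃ γ₁ : ℝ, 0 < γ₁ ∧ γ₁ ≤ 1 ∧ ∀ (F : T3Family) (γ : ℝ), F.L = L → 0 < γ → γ ≤ γ₁ → ∀ (K j : ℕ), 1 ≤ j → j ≤ K → ∀ (a : Plaq (F.P K) j), 1 / 2 ≤ (gibbsK F ℰp γ K).real ({U : GaugeField (F.P K) 0 (Matrix.specialUnitaryGroup (Fin 2) ℂ) | (∀ (i : ℕ) (q : Plaq (F.P K) i), i < j → Site.tdist (fun k => ((((q.src k).val * F.L ^ i : ℕ)) : ZMod ((F.P K).sitesPerDir 0))) (fun k => ((((a.src k).val * F.L ^ j : ℕ)) : ZMod ((F.P K).sitesPerDir 0))) + 64 * F.L ^ i ≤ 64 * F.L ^ j → GaugeGroup.dist1 (GaugeField.plaqHol (Averaging.iter (fun i' => BlockAveraging.blockAvg (P := F.P K) (j := i') ℰp) i U) q) < θBal F.L γ b₀ p₀ (K - i))} ∩ {U | GaugeGroup.dist1 (GaugeField.plaqHol (Averaging.iter (fun i' => BlockAveraging.blockAvg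 (P := F.P K) (j := i') ℰp) j U) a) ≤ m * Real.sqrt (γ * ((F.L : ℝ)⁻¹) ^ (K - j))})) :
    ∀ (L : ℕ) (ε : ℝ), 0 ≤ ε → ∀ (b₀ p₀ : ℝ), 0 < b₀ → 2 < p₀ → ∃ M₀ : ℝ, 0 ≤ M₀ ∧ ∃ γ₁ : ℝ, 0 < γ₁ ∧ γ₁ ≤ 1 ∧ ∀ (F : T3Family) (γ : ℝ), F.L = L → 0 < γ → γ ≤ γ₁ → ∀ (K j : ℕ), 1 ≤ j → j ≤ K → 3 ≤ F.m + K - j → ∀ (a : Plaq (F.P K) j), ∫ U in {U : GaugeField (F.P K) 0 (Matrix.specialUnitaryGroup (Fin 2) ℂ) | (∀ (i : ℕ) (q : Plaq (F.P K) i), i < j → Site.tdist (fun k => ((((q.src k).val * F.L ^ i : ℕ)) : ZMod ((F.P K).sitesPerDir 0))) (fun k => ((((a.src k).val * F.L ^ j : ℕ)) : ZMod ((F.P K).sitesPerDir 0))) + 64 * F.L ^ i ≤ 64 * F.L ^ j → GaugeGroup.dist1 (GaugeField.plaqHol (Averaging.iter (fun i' => BlockAveraging.blockAvg (P := F.P K)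 (j := i') ℰp) i U) q) < θBal F.L γ b₀ p₀ (K - i))}, Real.exp (ε * min (GaugeGroup.dist1 (GaugeField.plaqHol (Averaging.iter (fun i' => BlockAveraging.blockAvg (P := F.P K) (j := i') ℰp) j U) a) / Real.sqrt (γ * ((F.L : ℝ)⁻¹) ^ (K - j))) (B10.pFun b₀ p₀ (Real.sqrt (γ * ((F.L : ℝ)⁻¹) ^ (K - j))))) ∂(gibbsK F ℰp γ K) ≤ M₀ := by
  intro L ε hε b₀ p₀ hb₀ hp₀
  obtain ⟨Cc, cc, hCc, hcc, γa, hγa, hγa1, H1⟩ := hK1 L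
  obtain ⟨CL, hCL, H2⟩ := hK2 L
  obtain ⟨γb, hγb, hγb1, H2'⟩ := H2 b₀ p₀ hb₀ hp₀
  obtain ⟨m, hm, γc, hγc, hγc1, H3'⟩ := hMed L b₀ p₀ hb₀ hp₀
  refine ⟨(2 * (m + (CL + 1) * Real.sqrt (578 * Cc / cc)) + 1) * Real.exp (ε * (2 * (m + (CL + 1) * Real.sqrt (578 * Cc / cc)) + 1)) + 2 * Cc * Real.exp (ε + (ε + 1) ^ 2 / (4 * (cc / (1156 * (CL + 1) ^ 2)))), insertionBound_nonneg ε hCc hCL hm, min (min γa γb) (min γc (1 / 17)),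
    lt_min (lt_min hγa hγb) (lt_min hγc (by norm_num)), (min_le_left _ _).trans ((min_le_left _ _).trans hγa1), ?_⟩
  intro F γ hFL hγ hγle K j hj hjK h3 a
  have hγa' : γ ≤ γa := hγle.trans ((min_le_left _ _).trans (min_le_left _ _))
  have hγb' : γ ≤ γb := hγle.trans ((min_le_left _ _).trans (min_le_right _ _))
  have hγc' : γ ≤ γc := hγle.trans ((min_le_right _ _).trans (min_le_left _ _))
  have hγ17 : γ ≤ 1 / 17 := hγle.trans ((min_le_right _ _).trans (min_le_right _ _))
  have hL1 : (1 : ℝ) ≤ (F.L : ℝ) := by exact_mod_cast F.hL.2.le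
  have h17 : 17 * γ ≤ (F.L : ℝ) ^ (K - j) := by
    have : (1 : ℝ) ≤ (F.L : ℝ) ^ (K - j) := one_le_pow₀ hL1
    linarith
  exact insertion_step_of_boxFit F hγ hε hjK (boxFit_of_depth F h3) (boxBeta_of_coupling F hγ hjK h17) a hCc hcc hCL hm
    (H1 F γ hFL hγ hγa' K) (H2' F γ hFL hγ hγb' K j hj hjK a) (H3' F γ hFL hγ hγc' K j hj hjK a)

end Summit.QuantumFields.YangMills.Theorems.LocalInsertion.InsertionStepOfConcentrationBoxFit
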